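import Summits.QuantumFields.QCD.Theorems.GapBuysCauchyRateRotationRestorationDefs
import Summits.QuantumFields.QCD.Theorems.GapBuysCauchyRateRotationRestorationLatticeInvariancePassesToLimit
import Summits.QuantumFields.YangMills.Theorems.PencilRigidityNPointIsotropyRiemannSum
import Literature.MathematicalPhysics.QuantumFieldTheory.SchwingerLimitInheritance
import HarnessLib

/-!
# Stub `stub_onePointInvariance` (T2 of line `registered`, reshape r2, crux stmt-QuantumFields-8840
`RotationRestoration`) — PROVED

Tied one-point functions are invariant under every linear isometry.  If the lattice one-point functions
of the scheme `sch` factorise as `⟨Φ^{σ}_k(f)⟩ = w_k(σ) · a_k⁴ ∑_{x ∈ box_k} f(a_k x)` (the hypothesis, T1 of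
the line), then for every Schwinger family `S` tied to `sch` (`IsLatticeLimit sch S`), every species `σ`,
every linear isometry `A` of `ℝ⁴` and every real one-fold tensor `F = f₀` (complexified),
`S 1 σ (F ∘ A⁻¹) = S 1 σ F`.

Proof (soft; limits only):
* the Riemann sums `a_k⁴ ∑_{x ∈ box_k} g(a_k x)` converge to `∫ g` for every Schwartz `g`
  (`NPointIsotropy.ComplexRotationBandlimit.riemannSumBox`: `a_k → 0`, `a_k L_k → ∞`);
* in degree one every test function is off-diagonal (`isOffDiagonal_of_subsingleton`), so the tie applies
  to every real one-fold tensor;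
* testing the tie on ONE bump `g₀` with `∫ g₀ ≠ 0` (Mathlib `ContDiffBump`, `HasCompactSupport.toSchwartzMap`,
  `ContDiffBump.integral_pos`) gives `w_k(σ) · RS_k(g₀) → S 1 σ G₀`, whence
  `w_k(σ) → W := S 1 σ G₀ / ∫ g₀` (`Filter.Tendsto.div`, the Riemann sums being eventually non-zero);
* hence for every real one-fold tensor `F` of `f₀`: `S 1 σ F = lim w_k(σ) · RS_k(f₀) = W · ∫ f₀`
  (`tendsto_nhds_unique`);
* `F ∘ A⁻¹` is the tensor of `f₀ ∘ A⁻¹` (`LatticeInvariancePassesToLimit.isTensorOf_linActMulti_ofRealTest`)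
  and `∫ f₀ ∘ A⁻¹ = ∫ f₀` (`LinearIsometryEquiv.measurePreserving`, `MeasurePreserving.integral_comp`).

References: Osterwalder–Schrader 1973 §2 (Euclidean action on test functions); Glimm–Jaffe 1987 §9.5–9.6
(lattice approximation, Riemann sums of test functions). [folklore]
-/

noncomputable section

namespace Summit.QuantumFields.QCD.Cruxes.RotationRestoration.Birth

open scoped BigOperators Topology SchwartzMap
open Filter
open Literature.MathematicalPhysics.QuantumLattice Literature.MathematicalPhysics.AQFT
  Literature.MathematicalPhysics.QuantumFieldTheory
open Literature.Probability.LatticeModels (box)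

namespace OnePointInvariance

open MeasureTheory
open Summit.QuantumFields.YangMills.Theorems.NPointIsotropy.ComplexRotationBandlimit (riemannSumBox)

/-- The Riemann sums of a real Schwartz function over the exploding fine boxes of a scheme, cast to `ℂ`,
converge to its integral (`riemannSumBox` with `a_k > 0`, `a_k → 0`, `a_k L_k → ∞` from the scheme).
[folklore] -/
theorem tendsto_riemannSum_ofReal {Nf : ℕ} (sch : QCDScheme Nf) (g : 𝓢(EuclideanSpace ℝ (Fin 4), ℝ)) :
    Tendsto (fun k : ℕ => ((sch.a k ^ 4 * ∑ x ∈ box 4 (sch.L k), g (sch.a k • siteToE x) : ℝ) : ℂ))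
      atTop (𝓝 ((∫ x, g x : ℝ) : ℂ)) :=
  (Complex.continuous_ofReal.tendsto _).comp
    (riemannSumBox g sch.a sch.L sch.a_pos sch.tendsto_a sch.tendsto_L)

/-- There is a real Schwartz function on `ℝ⁴` with non-zero integral (a smooth bump). [folklore] -/
theorem exists_schwartz_integral_ne_zero :
    ∃ g : 𝓢(EuclideanSpace ℝ (Fin 4), ℝ), ∫ x, g x ≠ 0 := by
  let b : ContDiffBump (0 : EuclideanSpace ℝ (Fin 4)) := ⟨1, 2, one_pos, one_lt_two⟩
  exact ⟨b.hasCompactSupport.toSchwartzMap b.contDiff, (b.integral_pos (μ := volume)).ne'⟩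

/-- **Tied one-point functions are multiples of the integral.**  If the lattice one-point functions of
species `σ` factorise as `w_k · a_k⁴ ∑_{x ∈ box_k} f(a_k x)`, then for every `S` tied to the scheme there is
`W ∈ ℂ` with `S 1 σ F = W · ∫ f₀` for every real one-fold tensor `F` of `f₀`: testing the tie on a bump with
non-zero integral forces `w_k → W`, and the Riemann sums converge to the integral. [folklore] -/
theorem exists_eq_const_mul_integral {Nf : ℕ} {sch : QCDScheme Nf}
    {S : LabelledSchwingerFamily (QCDField Nf) (EuclideanSpace ℝ (Fin 4))} (hlim : IsLatticeLimit sch S)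
    (σ : Fin 1 → QCDField Nf) {w : ℕ → ℂ}
    (hw : ∀ (k : ℕ) (f : Fin 1 → 𝓢(EuclideanSpace ℝ (Fin 4), ℝ)),
      qcdLatticeSchwinger sch k 1 σ f =
        w k * ((sch.a k ^ 4 * ∑ x ∈ box 4 (sch.L k), f 0 (sch.a k • siteToE x) : ℝ) : ℂ)) :
    ∃ W : ℂ, ∀ (f : Fin 1 → 𝓢(EuclideanSpace ℝ (Fin 4), ℝ))
      (F : 𝓢((Fin 1 → EuclideanSpace ℝ (Fin 4)), ℂ)), IsTensorOf F (fun i => ofRealTest (f i)) →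
        S 1 σ F = W * ((∫ x, f 0 x : ℝ) : ℂ) := by
  obtain ⟨g₀, hg₀⟩ := exists_schwartz_integral_ne_zero
  -- the tie on the one-fold tensor `F₀` of the bump `g₀`
  have hF₀ : IsTensorOf (SchwartzMap.tensorFin 1 fun _ : Fin 1 => ofRealTest g₀)
      (fun i => ofRealTest ((fun _ : Fin 1 => g₀) i)) :=
    isTensorOf_tensorFin _
  have h₀ : Tendsto
      (fun k : ℕ => w k * ((sch.a k ^ 4 * ∑ x ∈ box 4 (sch.L k), g₀ (sch.a k • siteToE x) : ℝ) : ℂ))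
      atTop (𝓝 (S 1 σ (SchwartzMap.tensorFin 1 fun _ : Fin 1 => ofRealTest g₀))) :=
    (hlim 1 one_ne_zero σ (fun _ => g₀) _ hF₀ (isOffDiagonal_of_subsingleton _)).congr fun k =>
      hw k fun _ => g₀
  have hI : ((∫ x, g₀ x : ℝ) : ℂ) ≠ 0 := Complex.ofReal_ne_zero.2 hg₀
  have hR := tendsto_riemannSum_ofReal sch g₀
  -- `w_k → W`
  have hwlim : Tendsto w atTop
      (𝓝 (S 1 σ (SchwartzMap.tensorFin 1 fun _ : Fin 1 => ofRealTest g₀) / ((∫ x, g₀ x : ℝ) : ℂ))) := by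
    refine (h₀.div hR hI).congr' ?_
    filter_upwards [hR.eventually_ne hI] with k hk
    exact mul_div_cancel_right₀ (w k) hk
  refine ⟨S 1 σ (SchwartzMap.tensorFin 1 fun _ : Fin 1 => ofRealTest g₀) / ((∫ x, g₀ x : ℝ) : ℂ),
    fun f F hF => ?_⟩
  have h₁ : Tendsto (fun k : ℕ => qcdLatticeSchwinger sch k 1 σ f) atTop (𝓝 (S 1 σ F)) :=
    hlim 1 one_ne_zero σ f F hF (isOffDiagonal_of_subsingleton F)
  have h₂ : Tendsto (fun k : ℕ => qcdLatticeSchwinger sch k 1 σ f) atTop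
      (𝓝 (S 1 σ (SchwartzMap.tensorFin 1 fun _ : Fin 1 => ofRealTest g₀) / ((∫ x, g₀ x : ℝ) : ℂ) *
        ((∫ x, f 0 x : ℝ) : ℂ))) :=
    (hwlim.mul (tendsto_riemannSum_ofReal sch (f 0))).congr fun k => (hw k f).symm
  exact tendsto_nhds_unique h₁ h₂

end OnePointInvariance

/-- **Registered stub `stub_onePointInvariance` (T2) — tied one-point functions are invariant under every
linear isometry (PROVED).**  If the lattice one-point functions factorise as `w_k(σ) · a_k⁴ ∑_{x ∈ box_k} f(a_k x)`
(T1), then for every tied `S`, every species `σ`, every linear isometry `A` of `ℝ⁴` and every separated real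
`f` with one-fold tensor `F`: `S 1 σ (F ∘ A⁻¹) = S 1 σ F`.  Both sides equal `W · ∫ f₀`
(`OnePointInvariance.exists_eq_const_mul_integral`: `F ∘ A⁻¹` is the tensor of `f₀ ∘ A⁻¹`, and
`∫ f₀ ∘ A⁻¹ = ∫ f₀` by `LinearIsometryEquiv.measurePreserving`). -/
theorem stub_onePointInvariance :
    ∀ (Nf : ℕ) (sch : QCDScheme Nf)
      (S : LabelledSchwingerFamily (QCDField Nf) (EuclideanSpace ℝ (Fin 4))), IsLatticeLimit sch S →
      (∀ (k : ℕ) (σ : Fin 1 → QCDField Nf), ∃ w : ℂ, ∀ f : Fin 1 → 𝓢(EuclideanSpace ℝ (Fin 4), ℝ),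
        qcdLatticeSchwinger sch k 1 σ f =
          w * ((sch.a k ^ 4 * ∑ x ∈ box 4 (sch.L k), f 0 (sch.a k • siteToE x) : ℝ) : ℂ)) →
      ∀ (σ : Fin 1 → QCDField Nf) (A : EuclideanSpace ℝ (Fin 4) ≃ₗᵢ[ℝ] EuclideanSpace ℝ (Fin 4))
        (f : Fin 1 → 𝓢(EuclideanSpace ℝ (Fin 4), ℝ)), IsSeparated f →
        ∀ F : 𝓢((Fin 1 → EuclideanSpace ℝ (Fin 4)), ℂ), IsTensorOf F (fun i => ofRealTest (f i)) →
          S 1 σ (linActMulti A F) = S 1 σ F := by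
  intro Nf sch S hlim hfac σ A f _hf F hF
  choose w hw using hfac
  obtain ⟨W, hW⟩ :=
    OnePointInvariance.exists_eq_const_mul_integral hlim σ (w := fun k => w k σ) fun k g => hw k σ g
  have hF' : IsTensorOf (linActMulti A F) (fun i => ofRealTest (linActTest (𝕜 := ℝ) A (f i))) :=
    LatticeInvariancePassesToLimit.isTensorOf_linActMulti_ofRealTest A hF
  have hint : ∫ x, linActTest (𝕜 := ℝ) A (f 0) x = ∫ x, f 0 x :=
    A.symm.measurePreserving.integral_comp A.symm.toHomeomorph.measurableEmbedding (f 0)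
  rw [hW f F hF, hW _ _ hF', hint]

end Summit.QuantumFields.QCD.Cruxes.RotationRestoration.Birth

end
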